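import Mathlib
import Summits.ValiantsHypothesis.ValiantsHypothesis.Theorems.DivisionGapPerMultiplesHardStubHostDescent
import Summits.ValiantsHypothesis.ValiantsHypothesis.Theorems.DivisionGapPerMultiplesHardStubHostBlockProjection
import Summits.ValiantsHypothesis.ValiantsHypothesis.Theorems.DivisionGapPerMultiplesHardStubFaceDescent
import Literature.Computability.AlgebraicComplexity.ArithCircuitProofs
import Literature.Computability.AlgebraicComplexity.PermanentIrreducible

/-!
# `DivisionGap.PerMultiplesHard` (stmt-ValiantsHypothesis-5068), line `uncharged-face-walk`:
host descent INSIDE a host (stub `stub_hostDescentIn`)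

Let `G ⊆ [n]²` be a host with face permanent `per_G = Σ_{σ ⊆ G} x^{μ_σ}`, let `w` be a weight on
the cells, and let `G' ⊆ G` be the face `w` CUTS OUT OF `G`: a permutation lies inside `G'` iff it
lies inside `G` and its `w`-weight `Σ_i w (σ i, i)` is maximal among the permutations inside `G`.
Suppose some permutation lies inside `G'`.  For a multiplier `h` over `ℝ≥0` let
`q := proj_{G'} (top_w h)` be the top `w`-component of `h` with every variable OFF `G'` sent to `1`
(`proj_{G'} = aeval (fun e => if e ∈ G' then X e else 1)`).  Then

* `supp q = { m|_{G'} : m ∈ supp (top_w h) }`, `m|_{G'} = m.filter (· ∈ G')` — over `ℝ≥0`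
  coefficients add without cancellation (`HostDescent.support_aeval_proj`);
* `L⁺(per_{G'} · q) ≤ L⁺(per_G · h)`

for the tree's monotone fan-in-two `complexity` over `ℝ≥0`.  This is the landed
`HostDescent.stub_hostDescent` with `per_n` replaced by a face permanent `per_G`, which makes host
descents composable (faces of faces).

Mechanism.
1. `top_w per_G = per_{G'}` (`topComponent_facePer_eq_facePer`): the exponents of `per_G` are the
   `μ_σ`, `σ ⊆ G`, with coefficient `1` (`HostBlockProjection.coeff_sum_permMonomial`) and
   `w`-weight `Σ_i w (σ i, i)` (`FaceDescent.weight_permMonomial`); the `w`-degree of `per_G` is the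
   weight of the given `σ₀ ⊆ G'`, and `μ_σ`, `σ ⊆ G`, has this weight iff `σ ⊆ G'`.
2. Top components are free (`complexity_topComponent_le`) and multiplicative (`topComponent_mul`)
   over `ℝ≥0`: `L⁺(per_{G'} · top_w h) ≤ L⁺(per_G · h)`.
3. The projection off `G'` is free and fixes `per_{G'}`
   (`HostDescent.complexity_facePer_mul_aeval_proj_le`).

Log (stub-worker): written on the landed `HostDescent` / `HostBlockProjection` / `FaceDescent` /
`TopComponentFree` API; playbook: none fit. [folklore]
-/

noncomputable section

open MvPolynomial Literature.Computability.AlgebraicComplexity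
open scoped NNReal BigOperators
open Summit.ValiantsHypothesis.ValiantsHypothesis.Theorems.ZeroOneTransfer.Negative
open Summit.ValiantsHypothesis.ValiantsHypothesis.Theorems.DivisionGap.PerMultiplesHard.FaceDescent
  (weight_permMonomial)
open Summit.ValiantsHypothesis.ValiantsHypothesis.Theorems.DivisionGap.PerMultiplesHard.HostBlockProjection
  (coeff_sum_permMonomial exists_of_mem_support_sum_permMonomial)
open Summit.ValiantsHypothesis.ValiantsHypothesis.Theorems.DivisionGap.PerMultiplesHard.HostDescent
  (support_aeval_proj complexity_facePer_mul_aeval_proj_le)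

namespace Summit.ValiantsHypothesis.ValiantsHypothesis.Theorems.DivisionGap.PerMultiplesHard.HostDescentIn

variable {n : ℕ}

/-! ### The face permanent of a host and its top component -/

/-- `x^{μ_ρ}` occurs in `per_G = Σ_{σ ⊆ G} x^{μ_σ}` iff `ρ ⊆ G`. [folklore] -/
theorem permMonomial_mem_support_facePer_iff (G : Finset (Fin n × Fin n))
    (ρ : Equiv.Perm (Fin n)) :
    permMonomial ρ ∈ (∑ σ ∈ (Finset.univ : Finset (Equiv.Perm (Fin n))).filter
          (fun σ => ∀ i, (σ i, i) ∈ G), monomial (permMonomial σ) (1 : ℝ≥0)).support ↔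
      ∀ i, (ρ i, i) ∈ G := by
  classical
  rw [mem_support_iff, coeff_sum_permMonomial]
  simp only [Finset.mem_filter, Finset.mem_univ, true_and]
  constructor
  · intro h
    by_contra hρ
    exact h (if_neg hρ)
  · intro h
    rw [if_pos h]
    exact one_ne_zero

/-- If `G'` is cut out of `G` by `w` and `σ₀ ⊆ G'`, the `w`-degree of `per_G` is the `w`-weight
`Σ_i w (σ₀ i, i)` of `σ₀`. [folklore] -/
theorem weightedTotalDegree_facePer_eq (G G' : Finset (Fin n × Fin n)) (w : Fin n × Fin n → ℕ)
    (hcut : ∀ σ : Equiv.Perm (Fin n), (∀ i, (σ i, i) ∈ G') ↔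
      ((∀ i, (σ i, i) ∈ G) ∧ ∀ τ : Equiv.Perm (Fin n), (∀ i, (τ i, i) ∈ G) →
        (∑ i, w (τ i, i)) ≤ ∑ i, w (σ i, i)))
    {σ₀ : Equiv.Perm (Fin n)} (hσ₀ : ∀ i, (σ₀ i, i) ∈ G') :
    weightedTotalDegree w
        (∑ σ ∈ (Finset.univ : Finset (Equiv.Perm (Fin n))).filter (fun σ => ∀ i, (σ i, i) ∈ G),
          monomial (permMonomial σ) (1 : ℝ≥0)) = ∑ i, w (σ₀ i, i) := by
  classical
  obtain ⟨hσ₀G, hmax⟩ := (hcut σ₀).1 hσ₀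
  refine le_antisymm (Finset.sup_le fun d hd => ?_) ?_
  · obtain ⟨ρ, hρ, rfl⟩ := exists_of_mem_support_sum_permMonomial _ hd
    rw [weight_permMonomial]
    exact hmax ρ (by simpa using hρ)
  · rw [← weight_permMonomial w σ₀]
    exact le_weightedTotalDegree w ((permMonomial_mem_support_facePer_iff G σ₀).2 hσ₀G)

/-- **The inner face permanent is the top component of the outer one.**  If `G'` is cut out of
`G` by `w` and some permutation lies inside `G'`, then `top_w per_G = per_{G'}`. [folklore] -/
theorem topComponent_facePer_eq_facePer (G G' : Finset (Fin n × Fin n)) (w : Fin n × Fin n → ℕ)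
    (hcut : ∀ σ : Equiv.Perm (Fin n), (∀ i, (σ i, i) ∈ G') ↔
      ((∀ i, (σ i, i) ∈ G) ∧ ∀ τ : Equiv.Perm (Fin n), (∀ i, (τ i, i) ∈ G) →
        (∑ i, w (τ i, i)) ≤ ∑ i, w (σ i, i)))
    {σ₀ : Equiv.Perm (Fin n)} (hσ₀ : ∀ i, (σ₀ i, i) ∈ G') :
    topComponent w
        (∑ σ ∈ (Finset.univ : Finset (Equiv.Perm (Fin n))).filter (fun σ => ∀ i, (σ i, i) ∈ G),
          monomial (permMonomial σ) (1 : ℝ≥0)) =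
      ∑ σ ∈ (Finset.univ : Finset (Equiv.Perm (Fin n))).filter (fun σ => ∀ i, (σ i, i) ∈ G'),
        monomial (permMonomial σ) (1 : ℝ≥0) := by
  classical
  have hdeg := weightedTotalDegree_facePer_eq G G' w hcut hσ₀
  obtain ⟨hσ₀G, hmax⟩ := (hcut σ₀).1 hσ₀
  refine MvPolynomial.ext _ _ fun d => ?_
  rw [coeff_topComponent, hdeg]
  by_cases hd : ∃ ρ : Equiv.Perm (Fin n), permMonomial ρ = d
  · obtain ⟨ρ, rfl⟩ := hd
    rw [coeff_sum_permMonomial, coeff_sum_permMonomial, weight_permMonomial]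
    simp only [Finset.mem_filter, Finset.mem_univ, true_and]
    by_cases hρ' : ∀ i, (ρ i, i) ∈ G'
    · -- `ρ ⊆ G'`: inside `G` and of top weight
      obtain ⟨hρG, hρmax⟩ := (hcut ρ).1 hρ'
      have heq : ∑ i, w (ρ i, i) = ∑ i, w (σ₀ i, i) :=
        le_antisymm (hmax ρ hρG) (hρmax σ₀ hσ₀G)
      rw [if_pos heq, if_pos hρG, if_pos hρ']
    · rw [if_neg hρ']
      by_cases hρG : ∀ i, (ρ i, i) ∈ G
      · -- `ρ ⊆ G` but not `⊆ G'`: its weight is not the top weight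
        have hne : ∑ i, w (ρ i, i) ≠ ∑ i, w (σ₀ i, i) := fun heq =>
          hρ' ((hcut ρ).2 ⟨hρG, fun τ hτ => (hmax τ hτ).trans heq.ge⟩)
        rw [if_neg hne]
      · rw [if_neg hρG, ite_self]
  · -- `d` is not a permutation monomial: both sides vanish
    have h0 : ∀ S : Finset (Equiv.Perm (Fin n)),
        coeff d (∑ σ ∈ S, monomial (permMonomial σ) (1 : ℝ≥0)) = 0 := fun S => by
      by_contra hne
      obtain ⟨ρ, -, hρ⟩ := exists_of_mem_support_sum_permMonomial S (mem_support_iff.2 hne)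
      exact hd ⟨ρ, hρ⟩
    rw [h0, h0, ite_self]

/-! ### The stub -/

/-- **Host descent inside a host (stub `stub_hostDescentIn` of line `uncharged-face-walk`).**
If `G'` is cut out of the host `G` by `w` (a permutation lies inside `G'` iff it lies inside `G`
and its `w`-weight is maximal among the permutations inside `G`) and some permutation lies inside
`G'`, then with `q := proj_{G'} (top_w h)`: `supp q` is the set of `G'`-restrictions `m|_{G'}` of
the exponents `m` of `top_w h` (no cancellation over `ℝ≥0`), and `L⁺(per_{G'} · q) ≤ L⁺(per_G · h)`:
`top_w per_G = per_{G'}`, top components are free and multiplicative over `ℝ≥0`, and the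
projection off `G'` is free and fixes `per_{G'}`. [folklore] -/
theorem stub_hostDescentIn :
    ∀ (n : ℕ) (G G' : Finset (Fin n × Fin n)) (w : Fin n × Fin n → ℕ) (h : MvPolynomial (Fin n × Fin n) ℝ≥0),
      (∀ σ : Equiv.Perm (Fin n), (∀ i, (σ i, i) ∈ G') ↔
        ((∀ i, (σ i, i) ∈ G) ∧ ∀ τ : Equiv.Perm (Fin n), (∀ i, (τ i, i) ∈ G) →
          (∑ i, w (τ i, i)) ≤ ∑ i, w (σ i, i))) →
      (∃ σ : Equiv.Perm (Fin n), ∀ i, (σ i, i) ∈ G') →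
      (aeval (fun e => if e ∈ G' then (X e : MvPolynomial (Fin n × Fin n) ℝ≥0) else 1)
          (topComponent w h)).support =
        (topComponent w h).support.image (fun m => m.filter (fun e => e ∈ G')) ∧
      complexity ((∑ σ ∈ (Finset.univ : Finset (Equiv.Perm (Fin n))).filter (fun σ => ∀ i, (σ i, i) ∈ G'),
            monomial (permMonomial σ) (1 : ℝ≥0)) *
          aeval (fun e => if e ∈ G' then (X e : MvPolynomial (Fin n × Fin n) ℝ≥0) else 1) (topComponent w h)) ≤
        complexity ((∑ σ ∈ (Finset.univ : Finset (Equiv.Perm (Fin n))).filter (fun σ => ∀ i, (σ i, i) ∈ G),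
            monomial (permMonomial σ) (1 : ℝ≥0)) * h) := by
  intro n G G' w h hcut hex
  obtain ⟨σ₀, hσ₀⟩ := hex
  refine ⟨support_aeval_proj G' (topComponent w h), ?_⟩
  refine (complexity_facePer_mul_aeval_proj_le G' (topComponent w h)).trans ?_
  -- `per_{G'} = top_w per_G`; top components are multiplicative and free
  rw [← topComponent_facePer_eq_facePer G G' w hcut hσ₀, ← topComponent_mul]
  exact complexity_topComponent_le w _

end Summit.ValiantsHypothesis.ValiantsHypothesis.Theorems.DivisionGap.PerMultiplesHard.HostDescentIn

end
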